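import Summits.CriticalPhenomena.PercolationContinuityZ3.Theorems.SahiMasterFamilyFCombOneSharedPhi
import Summits.CriticalPhenomena.PercolationContinuityZ3.Theorems.SahiMasterFamilyFCombOneSharedFaces

/-!
# SCHEME Σ: the dictionary between faces and sections, and the leaver lemmas (support file)

Support file (prover seat `prim-bnk-2`, gen 31–32; `--supports stmt-CriticalPhenomena-4575`).  Plan: `SIGMA-ASSEMBLY-PLAN.md`
("Dictionary"); proof document `PROOF-THEOREM-I1.md` §0–§2.

For a one-shared pair `S : OneShared ι` with the structural hypotheses `OneShared.Good` (blocks disjoint, `e` outside both, the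
blocks and `e` cover the type, `B` depends only on `I + e`, `C` only on `J + e`), membership of a face part in `B` / `C` is read
off the sections of `…OneSharedData`: for a part `s` with `e ∉ s`, `s ∈ B ↔ s ∩ I ∈ B⁰|_R`, and with `e ∈ s`,
`s ∈ B ↔ s ∩ I ∈ B¹|_R`, for any `R ⊇ s ∩ I` (`mem_B_iff_secLow`, `mem_B_iff_secHigh`, the `C` versions, and the congruence
forms `memB_congr` / `memC_congr`); a part is determined by its two traces and the position of `e` (`part_eq_of_traces`).
Then the instance bridge to the unit sets of `…VOrderUnitMatchingFinset`, the row ground set `(J \ x_J) + e`, the invariance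
`dataI_A_congr` of the canonical down-set under `y ↦ y'` with the same `I`-trace, and the LEAVER lemmas: for a leaver (class S9b)
the two side conditions of `leaverMap` hold (`leaver_memP`, `leaver_memI`), so `leaverMap` evaluates (`leaverMap_eq`) and the
leaver's image lies in `leaverTargets`.  One definition (the hypothesis bundle `OneShared.Good`, a structure of Props); no `sorry`.
-/

namespace Summit.CriticalPhenomena.PercolationContinuityZ3.Theorems

namespace SahiFComb.Shift

open Finset FinsetFamily
open scoped Classical

variable {ι : Type*} [Fintype ι] [DecidableEq ι] [LinearOrder ι]

/-! ### Instance bridge to the unit sets of `…VOrderUnitMatchingFinset` -/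

omit [LinearOrder ι] in
/-- Membership in `negUnitSetF` written with the ambient instances (the definition in `…UnitMatchingFinset` uses the classical
`DecidableEq`; `Decidable` instances are subsingletons). [this work] -/
theorem mem_negUnitSetF_iff (B C : Finset (Finset ι)) (u : (Finset ι × Finset ι) × ℕ) :
    u ∈ ThreePartition.negUnitSetF B C ↔ Disjoint u.1.1 u.1.2 ∧
      ((u.2 = 0 ∧ (u.1.1 ∈ C ∧ u.1.1 ∉ B) ∧ (u.1.1 ∪ u.1.2)ᶜ ∈ B) ∨
        (u.2 = 1 ∧ (u.1.1 ∈ B ∧ u.1.1 ∉ C) ∧ (u.1.1 ∪ u.1.2)ᶜ ∈ C) ∨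
        (u.2 = 2 ∧ ((u.1.1 ∪ u.1.2)ᶜ ∈ B ∧ (u.1.1 ∪ u.1.2)ᶜ ∈ C) ∧ u.1.2 ∉ C)) := by
  unfold ThreePartition.negUnitSetF
  rw [Set.mem_setOf_eq]
  exact Iff.of_eq (by congr!)

omit [LinearOrder ι] in
/-- Membership in `posUnitSetF` written with the ambient instances. [this work] -/
theorem mem_posUnitSetF_iff (B C : Finset (Finset ι)) (u : (Finset ι × Finset ι) × ℕ) :
    u ∈ ThreePartition.posUnitSetF B C ↔ Disjoint u.1.1 u.1.2 ∧
      ((u.2 = 0 ∧ (u.1.1 ∈ B ∧ u.1.1 ∈ C) ∧ (u.1.1 ∪ u.1.2)ᶜ ∉ B) ∨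
        (u.2 = 1 ∧ (u.1.1 ∈ B ∧ u.1.1 ∈ C) ∧ (u.1.1 ∪ u.1.2)ᶜ ∉ C) ∨
        (u.2 = 2 ∧ ((u.1.1 ∪ u.1.2)ᶜ ∈ B ∧ (u.1.1 ∪ u.1.2)ᶜ ∉ C) ∧ u.1.2 ∈ C)) := by
  unfold ThreePartition.posUnitSetF
  rw [Set.mem_setOf_eq]
  exact Iff.of_eq (by congr!)

namespace OneShared

/-! ### The canonical down-set only depends on the `I`-trace of `y` -/

/-- `A` of the column data is canonical: it depends on `y` only through `y ∩ I`. [this work] -/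
theorem dataI_A_congr (S : OneShared ι) {y y' : Finset ι} (h : y ∩ S.I = y' ∩ S.I) : (S.dataI y).A = (S.dataI y').A := by
  rw [(S.dataI y).hA, (S.dataI y').hA, h]

variable {S : OneShared ι}

/-! ### Parts, traces and the position of `e` -/

/-- A part is determined by the position of `e` and its two traces. [this work] -/
theorem part_eq_of_traces {s s' : Finset ι} (he : S.e ∈ s ↔ S.e ∈ s') (hI : s ∩ S.I = s' ∩ S.I) (hJ : s ∩ S.J = s' ∩ S.J) :
    s = s' := by
  ext i
  rcases S.hcov i with rfl | hi | hi
  · exact he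
  · constructor
    · intro h; exact (mem_inter.1 (hI ▸ mem_inter.2 ⟨h, hi⟩ : i ∈ s' ∩ S.I)).1
    · intro h; exact (mem_inter.1 (hI.symm ▸ mem_inter.2 ⟨h, hi⟩ : i ∈ s ∩ S.I)).1
  · constructor
    · intro h; exact (mem_inter.1 (hJ ▸ mem_inter.2 ⟨h, hi⟩ : i ∈ s' ∩ S.J)).1
    · intro h; exact (mem_inter.1 (hJ.symm ▸ mem_inter.2 ⟨h, hi⟩ : i ∈ s ∩ S.J)).1

/-- A part avoiding `e` is the union of its two traces. [this work] -/
theorem part_eq_union_of_notMem {s : Finset ι} (he : S.e ∉ s) : s = (s ∩ S.I) ∪ (s ∩ S.J) := by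
  ext i
  simp only [mem_union, mem_inter]
  constructor
  · intro h
    rcases S.hcov i with rfl | hi | hi
    · exact absurd h he
    · exact Or.inl ⟨h, hi⟩
    · exact Or.inr ⟨h, hi⟩
  · rintro (⟨h, -⟩ | ⟨h, -⟩) <;> exact h

/-- For a part avoiding `e`, removing the `I`-block leaves the `J`-trace. [this work] -/
theorem sdiff_I_eq_inter_J {s : Finset ι} (he : S.e ∉ s) : s \ S.I = s ∩ S.J := by
  ext i
  simp only [mem_sdiff, mem_inter]
  constructor
  · rintro ⟨h, hI⟩
    rcases S.hcov i with rfl | hi | hi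
    · exact absurd h he
    · exact absurd hi hI
    · exact ⟨h, hi⟩
  · rintro ⟨h, hJ⟩; exact ⟨h, fun hI => disjoint_left.1 S.hIJ hI hJ⟩

/-- For a part avoiding `e`, removing the `J`-block leaves the `I`-trace. [this work] -/
theorem sdiff_J_eq_inter_I {s : Finset ι} (he : S.e ∉ s) : s \ S.J = s ∩ S.I := by
  ext i
  simp only [mem_sdiff, mem_inter]
  constructor
  · rintro ⟨h, hJ⟩
    rcases S.hcov i with rfl | hi | hi
    · exact absurd h he
    · exact ⟨h, hi⟩
    · exact absurd hi hJ
  · rintro ⟨h, hI⟩; exact ⟨h, fun hJ => disjoint_left.1 S.hIJ hI hJ⟩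

/-! ### Membership dictionary -/

/-- `B`-membership of a part avoiding `e` is membership of its `I`-trace in the lower section. [this work] -/
theorem mem_B_iff_secLow {s R : Finset ι} (he : S.e ∉ s) (hR : s ∩ S.I ⊆ R) : s ∈ S.B ↔ s ∩ S.I ∈ secLow R S.B := by
  rw [mem_secLow, S.hdepB s]
  have : s ∩ insert S.e S.I = s ∩ S.I := by
    ext i; simp only [mem_inter, mem_insert]
    constructor
    · rintro ⟨hi, rfl | h⟩
      · exact absurd hi he
      · exact ⟨hi, h⟩
    · rintro ⟨hi, h⟩; exact ⟨hi, Or.inr h⟩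
  rw [this]
  exact ⟨fun h => ⟨hR, h⟩, fun h => h.2⟩

/-- `B`-membership of a part containing `e` is membership of its `I`-trace in the upper section. [this work] -/
theorem mem_B_iff_secHigh {s R : Finset ι} (he : S.e ∈ s) (hR : s ∩ S.I ⊆ R) : s ∈ S.B ↔ s ∩ S.I ∈ secHigh R S.e S.B := by
  rw [mem_secHigh, S.hdepB s]
  have : s ∩ insert S.e S.I = insert S.e (s ∩ S.I) := by
    ext i; simp only [mem_inter, mem_insert]
    constructor
    · rintro ⟨hi, rfl | h⟩
      · exact Or.inl rfl
      · exact Or.inr ⟨hi, h⟩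
    · rintro (rfl | ⟨hi, h⟩)
      · exact ⟨he, Or.inl rfl⟩
      · exact ⟨hi, Or.inr h⟩
  rw [this]
  exact ⟨fun h => ⟨hR, h⟩, fun h => h.2⟩

/-- `C`-membership of a part avoiding `e`. [this work] -/
theorem mem_C_iff_secLow {s R : Finset ι} (he : S.e ∉ s) (hR : s ∩ S.J ⊆ R) : s ∈ S.C ↔ s ∩ S.J ∈ secLow R S.C := by
  rw [mem_secLow, S.hdepC s]
  have : s ∩ insert S.e S.J = s ∩ S.J := by
    ext i; simp only [mem_inter, mem_insert]
    constructor
    · rintro ⟨hi, rfl | h⟩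
      · exact absurd hi he
      · exact ⟨hi, h⟩
    · rintro ⟨hi, h⟩; exact ⟨hi, Or.inr h⟩
  rw [this]
  exact ⟨fun h => ⟨hR, h⟩, fun h => h.2⟩

/-- `C`-membership of a part containing `e`. [this work] -/
theorem mem_C_iff_secHigh {s R : Finset ι} (he : S.e ∈ s) (hR : s ∩ S.J ⊆ R) : s ∈ S.C ↔ s ∩ S.J ∈ secHigh R S.e S.C := by
  rw [mem_secHigh, S.hdepC s]
  have : s ∩ insert S.e S.J = insert S.e (s ∩ S.J) := by
    ext i; simp only [mem_inter, mem_insert]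
    constructor
    · rintro ⟨hi, rfl | h⟩
      · exact Or.inl rfl
      · exact Or.inr ⟨hi, h⟩
    · rintro (rfl | ⟨hi, h⟩)
      · exact ⟨he, Or.inl rfl⟩
      · exact ⟨hi, Or.inr h⟩
  rw [this]
  exact ⟨fun h => ⟨hR, h⟩, fun h => h.2⟩

/-- `B`-membership only depends on the `I`-trace and on the presence of `e`. [this work] -/
theorem memB_congr {s s' : Finset ι} (he : S.e ∈ s ↔ S.e ∈ s') (hI : s ∩ S.I = s' ∩ S.I) : s ∈ S.B ↔ s' ∈ S.B := by
  rw [S.hdepB s, S.hdepB s']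
  have : s ∩ insert S.e S.I = s' ∩ insert S.e S.I := by
    ext i
    simp only [mem_inter, mem_insert]
    constructor
    · rintro ⟨hi, rfl | h⟩
      · exact ⟨he.1 hi, Or.inl rfl⟩
      · have : i ∈ s' ∩ S.I := hI ▸ mem_inter.2 ⟨hi, h⟩
        exact ⟨(mem_inter.1 this).1, Or.inr h⟩
    · rintro ⟨hi, rfl | h⟩
      · exact ⟨he.2 hi, Or.inl rfl⟩
      · have : i ∈ s ∩ S.I := hI.symm ▸ mem_inter.2 ⟨hi, h⟩
        exact ⟨(mem_inter.1 this).1, Or.inr h⟩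
  rw [this]

/-- `C`-membership only depends on the `J`-trace and on the presence of `e`. [this work] -/
theorem memC_congr {s s' : Finset ι} (he : S.e ∈ s ↔ S.e ∈ s') (hJ : s ∩ S.J = s' ∩ S.J) : s ∈ S.C ↔ s' ∈ S.C := by
  rw [S.hdepC s, S.hdepC s']
  have : s ∩ insert S.e S.J = s' ∩ insert S.e S.J := by
    ext i
    simp only [mem_inter, mem_insert]
    constructor
    · rintro ⟨hi, rfl | h⟩
      · exact ⟨he.1 hi, Or.inl rfl⟩
      · have : i ∈ s' ∩ S.J := hJ ▸ mem_inter.2 ⟨hi, h⟩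
        exact ⟨(mem_inter.1 this).1, Or.inr h⟩
    · rintro ⟨hi, rfl | h⟩
      · exact ⟨he.2 hi, Or.inl rfl⟩
      · have : i ∈ s ∩ S.J := hJ.symm ▸ mem_inter.2 ⟨hi, h⟩
        exact ⟨(mem_inter.1 this).1, Or.inr h⟩
  rw [this]

/-! ### The row ground set `(J \ x_J) + e` -/

/-- Elements of the row ground set `(J \ x_J) + e` are outside `I`. [this work] -/
theorem notMem_I_of_mem_rowGround {xJ : Finset ι} {i : ι} (hi : i ∈ insert S.e (S.J \ xJ)) : i ∉ S.I := by
  rcases mem_insert.1 hi with rfl | h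
  · exact S.heI
  · exact fun hI => disjoint_left.1 S.hIJ hI (mem_sdiff.1 h).1

/-- The `(J+e)`-trace of a part is the part minus `I`. [this work] -/
theorem inter_insert_J_eq_sdiff_I (s : Finset ι) : s ∩ insert S.e S.J = s \ S.I := by
  ext i
  simp only [mem_inter, mem_insert, mem_sdiff]
  constructor
  · rintro ⟨hi, rfl | h⟩
    · exact ⟨hi, S.heI⟩
    · exact ⟨hi, fun hI => disjoint_left.1 S.hIJ hI h⟩
  · rintro ⟨hi, hI⟩
    rcases S.hcov i with rfl | h | h
    · exact ⟨hi, Or.inl rfl⟩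
    · exact absurd h hI
    · exact ⟨hi, Or.inr h⟩

/-! ### The leaver lemmas -/

/-- Membership in the leaver family `𝓟` of the routing data, unfolded. [this work] -/
theorem mem_routP_iff (p : Finset ι × Finset ι) :
    p ∈ S.rout.𝓟 ↔ p.1 ⊆ S.J ∧ p.2 ⊆ S.J ∧ Disjoint p.1 p.2 ∧ S.J \ (p.1 ∪ p.2) ∈ (S.dataJ p.1).A := by
  rw [S.rout.h𝓟, mem_filter, mem_product, mem_powerset, mem_powerset, routing_A_eq, ← (S.dataJ p.1).hA]
  tauto

/-- For a leaver, `(x_J, z_J)` belongs to the leaver family `𝓟`. [this work] -/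
theorem leaver_memP {x y : Finset ι} (hL : ((x, y), 2) ∈ S.leaverSet) :
    (x ∩ S.J, (S.J \ (x ∩ S.J)) \ (y ∩ S.J)) ∈ S.rout.𝓟 := by
  obtain ⟨hu, -, -, -, -, hyA⟩ := hL
  rw [mem_negUnitSetF_iff] at hu
  have hxy : Disjoint x y := hu.1
  rw [mem_routP_iff]
  refine ⟨inter_subset_right, sdiff_subset.trans sdiff_subset, disjoint_left.2 fun i hi h => (mem_sdiff.1 (mem_sdiff.1 h).1).2 hi, ?_⟩
  have h1 : x ∩ S.J ∪ (S.J \ (x ∩ S.J)) \ (y ∩ S.J) = S.J \ (y ∩ S.J) := by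
    ext i
    rw [mem_union, mem_sdiff, mem_sdiff, mem_sdiff]
    constructor
    · rintro (h | ⟨⟨hJ, -⟩, hy⟩)
      · exact ⟨(mem_inter.1 h).2, fun hy => disjoint_left.1 hxy (mem_inter.1 h).1 (mem_inter.1 hy).1⟩
      · exact ⟨hJ, hy⟩
    · rintro ⟨hJ, hy⟩
      by_cases hx : i ∈ x ∩ S.J
      · exact Or.inl hx
      · exact Or.inr ⟨⟨hJ, hx⟩, hy⟩
  have : S.J \ (x ∩ S.J ∪ (S.J \ (x ∩ S.J)) \ (y ∩ S.J)) = y ∩ S.J := by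
    rw [h1, sdiff_sdiff_right_self, inf_eq_inter, inter_eq_right.2 inter_subset_right]
  simp only
  rw [this]
  exact hyA

/-- For a leaver, `x_I ∈ σ(Q \ P) = σΔ` (the domain of `Φ_ℓ`). [this work] -/
theorem leaver_memI {x y : Finset ι} (hL : ((x, y), 2) ∈ S.leaverSet) :
    x ∩ S.I ∈ (secHigh (S.I \ (y ∩ S.I)) S.e S.B \ secLow (S.I \ (y ∩ S.I)) S.B).image
      fun t => (S.I \ (y ∩ S.I)) \ t := by
  obtain ⟨hu, -, hex, hey, hzI, -⟩ := hL
  rw [mem_negUnitSetF_iff] at hu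
  obtain ⟨hxy, h⟩ := hu
  simp only at hxy h hex hey hzI
  rcases h with ⟨h0, -⟩ | ⟨h1, -⟩ | ⟨-, ⟨hzB, -⟩, -⟩
  · exact absurd h0 (by norm_num)
  · exact absurd h1 (by norm_num)
  have hez : S.e ∈ (x ∪ y)ᶜ := by rw [mem_compl, mem_union, not_or]; exact ⟨hex, hey⟩
  have hzIeq : (x ∪ y)ᶜ ∩ S.I = (S.I \ (y ∩ S.I)) \ (x ∩ S.I) := compl_union_inter_eq x y S.I
  rw [mem_image_ground_sdiff _ (fun s hs => (mem_secHigh.1 (mem_sdiff.1 hs).1).1), mem_sdiff]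
  refine ⟨inter_subset_sdiff_inter hxy S.I, ?_, hzI⟩
  rw [← hzIeq]
  exact (mem_B_iff_secHigh hez (hzIeq ▸ sdiff_subset)).1 hzB

/-- `leaverMap` evaluated on a leaver. [this work] -/
theorem leaverMap_eq {x y : Finset ι} (hL : ((x, y), 2) ∈ S.leaverSet) :
    S.leaverMap ((x, y), 2) =
      ((((S.dataI y).Φl ⟨x ∩ S.I, leaver_memI hL⟩ : Finset ι) ∪
          ((S.rout.ρ ⟨_, leaver_memP hL⟩ : ↥S.rout.𝓟) : Finset ι × Finset ι).2 ∪ {S.e},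
        (y ∩ S.I) ∪ ((S.rout.ρ ⟨_, leaver_memP hL⟩ : ↥S.rout.𝓟) : Finset ι × Finset ι).1), 0) := by
  unfold OneShared.leaverMap
  rw [dif_pos (leaver_memP hL), dif_pos (leaver_memI hL)]

/-- The image of a leaver lies in `leaverTargets`. [this work] -/
theorem leaverMap_mem_leaverTargets {x y : Finset ι} (hL : ((x, y), 2) ∈ S.leaverSet) :
    S.leaverMap ((x, y), 2) ∈ S.leaverTargets := by
  unfold OneShared.leaverTargets
  exact mem_image.2 ⟨(x, y), mem_filter.2 ⟨mem_univ _, hL⟩, rfl⟩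

/-- `φ` of a leaver is `leaverMap`. [this work] -/
theorem phi_eq_leaverMap {x y : Finset ι} (hL : ((x, y), 2) ∈ S.leaverSet) : S.phi ((x, y), 2) = S.leaverMap ((x, y), 2) := by
  have hL' := hL
  obtain ⟨-, -, hex, -, hzI, -⟩ := hL'
  simp only at hex hzI
  unfold OneShared.phi
  simp only [hex, if_false, if_true, show ((2 : ℕ) = 0) = False by simp, show ((2 : ℕ) = 1) = False by simp, hzI, hL]

end OneShared

end SahiFComb.Shift

end Summit.CriticalPhenomena.PercolationContinuityZ3.Theorems
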